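import Summits.Ventures.DiscreteObjects.PP12.FlagExteriorPencil
import Summits.Ventures.DiscreteObjects.PP12.OrbitStructureOrderThree

/-!
# Index sets of the `f = 10` flag-cell orbit matrix: cardinalities (kernel; Step A of the FlagTenOrbitReduction roadmap)
Framing: lottery ticket; floor = certified bounds/negative ranges.

Cell pub-namedobj (venture DiscreteObjects), target (M), designs gen 13 (HOME FAMILY-FLAG7X §7, Step A). For a flag-type collineation `σ`
(`σ³ = 1`) of a projective plane of order 12 with exactly 10 fixed points (`c, y₁..y₉ ∈ l`; fixed lines `l, m₁..m₉ ∋ c`), the data of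
`FlagTenOrbitData` are indexed by: the 12 points `≠ c` of a non-fixed line `u₀ ∋ c` (↔ the 12 exterior orbit-triangles), the 9 fixed lines
`≠ l`, the 9 fixed points `≠ c`, and, for each fixed line `m ≠ l` (resp. fixed point `y ≠ c`), the 4 orbits of the 12 points `≠ c` of `m`
(resp. of the 12 lines `≠ l` through `y`). This file proves these CARDINALITIES, via one permutation lemma:
* `card_image_orb3` — for `τ³ = 1` and a `τ`-stable finite set `S` of non-fixed points, `3 · #(S.image (orb3 τ)) = #S`
  (the orbits partition `S` into triples);
* `card_points_ne_c_on_line` (= 12), `card_fixedLines_ne` (= 9), `card_fixedPoints_ne` (= 9), `exists_cline_not_fixed`,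
  **`card_orbits_on_fixedLine`** (= 4) and **`card_lineOrbits_through_fixedPoint`** (= 4).
No `sorry`, no new axioms.
-/

namespace Summit.Ventures.DiscreteObjects.PP12

open Configuration Finset
open scoped Classical

section Perm

variable {α : Type*}

/-- **Orbits partition a stable set into triples** (`τ³ = 1`): if every point of `S` is moved by `τ` and `τ S ⊆ S`, then
`3 · #(S.image (orb3 τ)) = #S`. -/
theorem card_image_orb3 (τ : Equiv.Perm α) (h : τ ^ 3 = 1) (S : Finset α) (hS : ∀ x ∈ S, τ x ∈ S) (hnf : ∀ x ∈ S, τ x ≠ x) :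
    3 * (S.image (orb3 τ)).card = S.card := by
  -- S is the disjoint union of its orbits
  have hsub : ∀ x ∈ S, orb3 τ x ⊆ S := by
    intro x hx y hy
    rw [mem_orb3] at hy
    rcases hy with rfl | rfl | rfl
    · exact hx
    · exact hS _ hx
    · exact hS _ (hS _ hx)
  have hunion : (S.image (orb3 τ)).biUnion id = S := by
    ext y
    simp only [mem_biUnion, mem_image, id]
    constructor
    · rintro ⟨O, ⟨x, hx, rfl⟩, hy⟩; exact hsub x hx hy
    · intro hy; exact ⟨orb3 τ y, ⟨y, hy, rfl⟩, self_mem_orb3 _ _⟩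
  have hdisj : ∀ O ∈ S.image (orb3 τ), ∀ O' ∈ S.image (orb3 τ), O ≠ O' → Disjoint (id O) (id O') := by
    intro O hO O' hO' hne
    obtain ⟨x, -, rfl⟩ := mem_image.1 hO
    obtain ⟨x', -, rfl⟩ := mem_image.1 hO'
    rw [Finset.disjoint_left]
    intro y hy hy'
    exact hne ((orb3_eq_of_mem τ h hy).symm.trans (orb3_eq_of_mem τ h hy'))
  have hcard := Finset.card_biUnion hdisj
  rw [hunion] at hcard
  rw [hcard, Finset.sum_const_nat (m := 3) fun O hO => ?_]
  · ring
  · obtain ⟨x, hx, rfl⟩ := mem_image.1 hO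
    exact card_orb3_of_ne τ h (hnf x hx)

end Perm

namespace Collineation

variable {P L : Type*} [Membership P L] [ProjectivePlane P L] [Fintype P] [Fintype L] (σ : Collineation P L)

/-- number of points on a line: `n + 1` -/
theorem card_points_on_line (m : L) : (univ.filter fun p : P => p ∈ m).card = ProjectivePlane.order P L + 1 := by
  have := card_common_points (P := P) m m
  rw [if_pos rfl] at this
  rw [← this]; congr 1; ext p; simp

/-- number of lines through a point: `n + 1` -/
theorem card_lines_through (p : P) : (univ.filter fun m : L => p ∈ m).card = ProjectivePlane.order P L + 1 := by
  have := card_common_lines (L := L) p p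
  rw [if_pos rfl] at this
  rw [← this]; congr 1; ext m; simp

/-- points of a line other than a given point on it: `n` -/
theorem card_points_ne_on_line {m : L} {c : P} (hcm : c ∈ m) :
    (univ.filter fun p : P => p ∈ m ∧ p ≠ c).card = ProjectivePlane.order P L := by
  have h := card_points_on_line (P := P) m
  have : (univ.filter fun p : P => p ∈ m ∧ p ≠ c) = (univ.filter fun p : P => p ∈ m).erase c := by
    ext p; simp only [mem_filter, mem_univ, true_and, mem_erase]; tauto
  rw [this, card_erase_of_mem ((mem_filter.2 ⟨mem_univ c, hcm⟩ : c ∈ univ.filter fun p : P => p ∈ m)), h]; simp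

/-- lines through a point other than a given line through it: `n` -/
theorem card_lines_ne_through {y : P} {l : L} (hyl : y ∈ l) :
    (univ.filter fun m : L => y ∈ m ∧ m ≠ l).card = ProjectivePlane.order P L := by
  have h := card_lines_through (L := L) y
  have : (univ.filter fun m : L => y ∈ m ∧ m ≠ l) = (univ.filter fun m : L => y ∈ m).erase l := by
    ext m; simp only [mem_filter, mem_univ, true_and, mem_erase]; tauto
  rw [this, card_erase_of_mem ((mem_filter.2 ⟨mem_univ l, hyl⟩ : l ∈ univ.filter fun m : L => y ∈ m)), h]; simp

/-- fixed lines other than `l`: `f − 1`, `f` = number of fixed POINTS (Baer's equality) -/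
theorem card_fixedLines_ne {l : L} (hl : σ.onLines l = l) :
    (univ.filter fun m : L => σ.onLines m = m ∧ m ≠ l).card = fixedCard σ.onPoints - 1 := by
  rw [σ.fixedCard_points_eq_lines]
  have : (univ.filter fun m : L => σ.onLines m = m ∧ m ≠ l) = (univ.filter fun m : L => σ.onLines m = m).erase l := by
    ext m; simp only [mem_filter, mem_univ, true_and, mem_erase]; tauto
  rw [this, card_erase_of_mem ((mem_filter.2 ⟨mem_univ l, hl⟩ : l ∈ univ.filter fun m : L => σ.onLines m = m))]; rfl

omit [ProjectivePlane P L] [Fintype L] in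
/-- fixed points other than `c`: `f − 1` -/
theorem card_fixedPoints_ne {c : P} (hc : σ.onPoints c = c) :
    (univ.filter fun p : P => σ.onPoints p = p ∧ p ≠ c).card = fixedCard σ.onPoints - 1 := by
  have : (univ.filter fun p : P => σ.onPoints p = p ∧ p ≠ c) = (univ.filter fun p : P => σ.onPoints p = p).erase c := by
    ext p; simp only [mem_filter, mem_univ, true_and, mem_erase]; tauto
  rw [this, card_erase_of_mem ((mem_filter.2 ⟨mem_univ c, hc⟩ : c ∈ univ.filter fun p : P => σ.onPoints p = p))]; rfl

section Flag

variable {l : L} {c : P} (hl : σ.onLines l = l) (hc : σ.onPoints c = c) (hcl : c ∈ l)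
  (hP : ∀ p : P, σ.onPoints p = p → p ∈ l) (hL : ∀ m : L, σ.onLines m = m → c ∈ m)

/-- **A non-fixed line through `c` exists** as soon as `f ≤ n` (e.g. order 12, `f = 10`): the fixed lines are `f` of the `n + 1` lines
through `c`. -/
theorem exists_cline_not_fixed (hf : fixedCard σ.onPoints ≤ ProjectivePlane.order P L) : ∃ u : L, c ∈ u ∧ σ.onLines u ≠ u := by
  by_contra h
  push Not at h
  -- every line through c is fixed ⇒ n + 1 ≤ f
  have hsub : (univ.filter fun m : L => c ∈ m) ⊆ univ.filter fun m : L => σ.onLines m = m := by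
    intro m hm; rw [mem_filter] at hm ⊢; exact ⟨mem_univ _, h m hm.2⟩
  have := card_le_card hsub
  rw [card_lines_through] at this
  change ProjectivePlane.order P L + 1 ≤ fixedCard σ.onLines at this
  rw [← σ.fixedCard_points_eq_lines] at this
  omega

omit [Fintype L] in
include hc hcl hP hL in
/-- The points `≠ c` of a fixed line `m ≠ l` are moved by `σ`, and `σ` permutes them. -/
theorem fixedLine_points_moved {m : L} (hm : σ.onLines m = m) (hml : m ≠ l) :
    (∀ p ∈ (univ.filter fun p : P => p ∈ m ∧ p ≠ c), σ.onPoints p ∈ (univ.filter fun p : P => p ∈ m ∧ p ≠ c)) ∧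
    (∀ p ∈ (univ.filter fun p : P => p ∈ m ∧ p ≠ c), σ.onPoints p ≠ p) := by
  have hcm : c ∈ m := hL m hm
  have key : ∀ p : P, p ∈ m → p ≠ c → σ.onPoints p ≠ p := fun p hpm hpc hpf =>
    hpc ((Nondegenerate.eq_or_eq hpm hcm (hP p hpf) hcl).resolve_right hml)
  refine ⟨fun p hp => ?_, fun p hp => ?_⟩
  · rw [mem_filter] at hp ⊢
    refine ⟨mem_univ _, (σ.mem_fixedLine_iff hm p).2 hp.2.1, fun e => hp.2.2 ?_⟩
    apply σ.onPoints.injective; rw [e, hc]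
  · rw [mem_filter] at hp; exact key p hp.2.1 hp.2.2

include hc hcl hP hL in
/-- **Orbits on a fixed line `m ≠ l`:** the `n` points `≠ c` of `m` fall into `n / 3` orbits of size 3 (`σ³ = 1`);
`3 · #orbits = n` (order 12: four orbits — the index set `Fin 4` of `γ j` in `FlagTenOrbitData`). -/
theorem card_orbits_on_fixedLine (hq : σ.onPoints ^ 3 = 1) {m : L} (hm : σ.onLines m = m) (hml : m ≠ l) :
    3 * ((univ.filter fun p : P => p ∈ m ∧ p ≠ c).image (orb3 σ.onPoints)).card = ProjectivePlane.order P L := by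
  obtain ⟨h1, h2⟩ := σ.fixedLine_points_moved hc hcl hP hL hm hml
  rw [card_image_orb3 σ.onPoints hq _ h1 h2, card_points_ne_on_line (hL m hm)]

omit [Fintype P] in
include hl hcl hP hL in
/-- The lines `≠ l` through a fixed point `y ≠ c` are moved by `σ`, and `σ` permutes them. -/
theorem fixedPoint_lines_moved {y : P} (hy : σ.onPoints y = y) (hyc : y ≠ c) :
    (∀ m ∈ (univ.filter fun m : L => y ∈ m ∧ m ≠ l), σ.onLines m ∈ (univ.filter fun m : L => y ∈ m ∧ m ≠ l)) ∧
    (∀ m ∈ (univ.filter fun m : L => y ∈ m ∧ m ≠ l), σ.onLines m ≠ m) := by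
  have hyl : y ∈ l := hP y hy
  have key : ∀ m : L, y ∈ m → m ≠ l → σ.onLines m ≠ m := fun m hym hml hmf =>
    hml ((Nondegenerate.eq_or_eq (hL m hmf) hym hcl hyl).resolve_left hyc.symm)
  refine ⟨fun m hm => ?_, fun m hm => ?_⟩
  · rw [mem_filter] at hm ⊢
    refine ⟨mem_univ _, by have := σ.mem_map hm.2.1; rwa [hy] at this, fun e => hm.2.2 ?_⟩
    apply σ.onLines.injective; rw [e, hl]
  · rw [mem_filter] at hm; exact key m hm.2.1 hm.2.2

include hl hcl hP hL in
/-- **Line orbits through a fixed point `y ≠ c`:** the `n` lines `≠ l` through `y` fall into `n / 3` orbits of size 3 (`σ³ = 1`);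
`3 · #orbits = n` (order 12: four orbits — the index set `Fin 4` of `C k` in `FlagTenOrbitData`). -/
theorem card_lineOrbits_through_fixedPoint (hq : σ.onPoints ^ 3 = 1) {y : P} (hy : σ.onPoints y = y) (hyc : y ≠ c) :
    3 * ((univ.filter fun m : L => y ∈ m ∧ m ≠ l).image (orb3 σ.onLines)).card = ProjectivePlane.order P L := by
  obtain ⟨h1, h2⟩ := σ.fixedPoint_lines_moved hl hcl hP hL hy hyc
  rw [card_image_orb3 σ.onLines (σ.onLines_pow_eq_one hq) _ h1 h2, card_lines_ne_through (hP y hy)]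

section OrderTwelve

variable (h12 : ProjectivePlane.order P L = 12)

include h12 hc hcl hP hL in
/-- Order 12: exactly four orbits on each fixed line `m ≠ l`. -/
theorem card_orbits_on_fixedLine_eq_four (hq : σ.onPoints ^ 3 = 1) {m : L} (hm : σ.onLines m = m) (hml : m ≠ l) :
    ((univ.filter fun p : P => p ∈ m ∧ p ≠ c).image (orb3 σ.onPoints)).card = 4 := by
  have := σ.card_orbits_on_fixedLine hc hcl hP hL hq hm hml; rw [h12] at this; omega

include h12 hl hcl hP hL in
/-- Order 12: exactly four line orbits `≠ l` through each fixed point `y ≠ c`. -/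
theorem card_lineOrbits_through_fixedPoint_eq_four (hq : σ.onPoints ^ 3 = 1) {y : P} (hy : σ.onPoints y = y) (hyc : y ≠ c) :
    ((univ.filter fun m : L => y ∈ m ∧ m ≠ l).image (orb3 σ.onLines)).card = 4 := by
  have := σ.card_lineOrbits_through_fixedPoint hl hcl hP hL hq hy hyc; rw [h12] at this; omega

include h12 in
/-- Order 12: twelve points `≠ c` on a line through `c` (the index set `Fin 12` of the triangles, via a non-fixed line `u₀ ∋ c`). -/
theorem card_points_ne_on_line_eq_twelve {u : L} (hcu : c ∈ u) : (univ.filter fun p : P => p ∈ u ∧ p ≠ c).card = 12 := by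
  rw [card_points_ne_on_line hcu, h12]

/-- Order 12, `f = 10`: nine fixed lines `≠ l` and nine fixed points `≠ c` (the index sets `Fin 9`). -/
theorem card_fixed_ne_eq_nine (hf : fixedCard σ.onPoints = 10) (hl : σ.onLines l = l) (hc : σ.onPoints c = c) :
    (univ.filter fun m : L => σ.onLines m = m ∧ m ≠ l).card = 9 ∧ (univ.filter fun p : P => σ.onPoints p = p ∧ p ≠ c).card = 9 := by
  rw [σ.card_fixedLines_ne hl, σ.card_fixedPoints_ne hc, hf]; exact ⟨rfl, rfl⟩

include h12 in
/-- Order 12, `f = 10`: a non-fixed line through `c` exists (three of them, one orbit). -/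
theorem exists_cline_not_fixed_ten (hf : fixedCard σ.onPoints = 10) : ∃ u : L, c ∈ u ∧ σ.onLines u ≠ u :=
  σ.exists_cline_not_fixed (c := c) (by rw [hf, h12]; norm_num)

end OrderTwelve

end Flag

end Collineation

end Summit.Ventures.DiscreteObjects.PP12
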